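import Summits.Ventures.YMGap.RobustBall.WilsonLoopBoundaryDecay
import Literature.MathematicalPhysics.QuantumLattice.WilsonLoops
import HarnessLib

/-!
# Venture YMGap, track ROBUST-BALL — ONE STATE AT A RATE for RECTANGULAR WILSON LOOPS `W(R,T)` and PLAQUETTES: the numbers a lattice
# practitioner reads

HONEST FRAMING. WHAT THIS IS: a venture file (cell `pub-ymgap`, track Y2 ROBUST-BALL, seat ds-3, theorems only): `WilsonLoopBoundaryDecay.lean`
read on the rectangular loops `rectWalk x i j R T` of the tree (`length_rectWalk = 2(R+T)`), in particular on plaquettes (`R = T = 1`):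
* ★ `su2_wilson_rectangle_boundary_upTo_oneTwelfth` — `SU(2)` on `ℤ⁴`, `0 ≤ β_W ≤ 1/12` (tree coupling `β_W/2`): for EVERY DLR state `μ`, every
  finite volume `Λ`, EVERY boundary field `η` and every `R × T` rectangle whose links are at depth `≥ D` in `Λ`:
  `|⟨W(R,T)⟩_{Λ,η} − ⟨W(R,T)⟩_μ| ≤ 16 · (R+T)² · (1/2)^{⌊D⌋}`;
* ★ `su2_wilson_plaquette_boundary_upTo_oneTwelfth` — plaquettes: `|⟨W_p⟩_{Λ,η} − ⟨W_p⟩_μ| ≤ 64 · (1/2)^{⌊D⌋}` — e.g. `≤ 1/16` at depth `10`,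
  `≤ 6.1·10⁻⁵` at depth `20`; box form `su2_wilson_rectangle_box_upTo_oneTwelfth` (`16(R+T)² 2^{−(n−m)}`).
WHAT THIS IS NOT: Dobrushin-comparison lower bound on the rate inside the single-link door; lattice strong coupling; nothing about the continuum
limit or the Clay Millennium problem.

References: the seat's `WilsonLoopBoundaryDecay.lean`; tree `Literature/MathematicalPhysics/QuantumLattice/WilsonLoops.lean` (`rectWalk`).
-/

noncomputable section

open MeasureTheory Filter Function ProbabilityTheory Real SimpleGraph
open scoped NNReal
open Literature.Probability.LatticeModels
open Literature.MathematicalPhysics.QuantumLattice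
open Literature.MathematicalPhysics.QuantumFieldTheory hiding ZdEdge Site
open Literature.MathematicalPhysics.QuantumFieldTheory (walkEdges)

namespace Summit.Ventures.YMGap.RobustBall

/-- ★ **RECTANGULAR WILSON LOOPS, `SU(2)` on `ℤ⁴`, `0 ≤ β_W ≤ 1/12`**: for EVERY DLR state `μ`, every volume `Λ`, EVERY boundary field `η`, and every
`R × T` rectangle at `x` in the `(i,j)` plane whose links are at depth `≥ D` in `Λ`:
`|∫ W(R,T) dγ_Λ(· | η) − ∫ W(R,T) dμ| ≤ 16 · (R+T)² · (1/2)^{⌊D⌋}`. [folklore] -/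
theorem su2_wilson_rectangle_boundary_upTo_oneTwelfth {βW : ℝ} (h0 : 0 ≤ βW) (h : βW ≤ 1 / 12)
    {μ : Measure (LGConfig 4 (SUN 2))} (hμ : μ ∈ ymGibbsMeasures (d := 4) (fundamentalRep (Fin 2)) (βW / 2))
    (Λ : Finset (ZdEdge 4)) (η : LGConfig 4 (SUN 2)) (x : Literature.Probability.LatticeModels.Site 4) (i j : Fin 4) (R T : ℕ) {D : ℝ}
    (hD : ∀ y ∈ walkEdges (rectWalk x i j R T), ∀ z, z ∉ Λ → D ≤ ‖y.1 - z.1‖) :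
    |(∫ U, loopTerm 2 1 (rectWalk x i j R T) U ∂(ymSpecification (d := 4) (fundamentalRep (Fin 2)) (βW / 2) Λ η)) -
        ∫ U, loopTerm 2 1 (rectWalk x i j R T) U ∂μ| ≤ 16 * ((R : ℝ) + T) ^ 2 * (1 / 2 : ℝ) ^ ⌊D⌋₊ := by
  have key := su2_wilson_loop_boundary_upTo_oneTwelfth h0 h hμ Λ η (rectWalk x i j R T) hD
  rw [length_rectWalk] at key
  refine key.trans (le_of_eq ?_)
  push_cast
  ring

/-- **Boxes**: rectangle with links based in `[−m, m]⁴`, box `[−n, n]⁴`, ANY boundary field: `≤ 16 · (R+T)² · (1/2)^{n − m}`. [folklore] -/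
theorem su2_wilson_rectangle_box_upTo_oneTwelfth {βW : ℝ} (h0 : 0 ≤ βW) (h : βW ≤ 1 / 12)
    {μ : Measure (LGConfig 4 (SUN 2))} (hμ : μ ∈ ymGibbsMeasures (d := 4) (fundamentalRep (Fin 2)) (βW / 2))
    {m : ℕ} (n : ℕ) (η : LGConfig 4 (SUN 2)) (x : Literature.Probability.LatticeModels.Site 4) (i j : Fin 4) (R T : ℕ)
    (hw : walkEdges (rectWalk x i j R T) ⊆ boxLinks 4 m) :
    |(∫ U, loopTerm 2 1 (rectWalk x i j R T) U ∂(ymSpecification (d := 4) (fundamentalRep (Fin 2)) (βW / 2) (boxLinks 4 n) η)) -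
        ∫ U, loopTerm 2 1 (rectWalk x i j R T) U ∂μ| ≤ 16 * ((R : ℝ) + T) ^ 2 * (1 / 2 : ℝ) ^ (n - m) := by
  have key := su2_wilson_loop_box_upTo_oneTwelfth h0 h hμ n η (rectWalk x i j R T) hw
  rw [length_rectWalk] at key
  refine key.trans (le_of_eq ?_)
  push_cast
  ring

/-- ★ **PLAQUETTES, `SU(2)` on `ℤ⁴`, `0 ≤ β_W ≤ 1/12`**: for EVERY DLR state, every volume, EVERY boundary field and every plaquette at depth `≥ D`:
`|⟨W_p⟩_{Λ,η} − ⟨W_p⟩_μ| ≤ 64 · (1/2)^{⌊D⌋}` (`W_p = Re tr U_p / 2` as the `1 × 1` rectangle loop). [folklore] -/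
theorem su2_wilson_plaquette_boundary_upTo_oneTwelfth {βW : ℝ} (h0 : 0 ≤ βW) (h : βW ≤ 1 / 12)
    {μ : Measure (LGConfig 4 (SUN 2))} (hμ : μ ∈ ymGibbsMeasures (d := 4) (fundamentalRep (Fin 2)) (βW / 2))
    (Λ : Finset (ZdEdge 4)) (η : LGConfig 4 (SUN 2)) (x : Literature.Probability.LatticeModels.Site 4) (i j : Fin 4) {D : ℝ}
    (hD : ∀ y ∈ walkEdges (rectWalk x i j 1 1), ∀ z, z ∉ Λ → D ≤ ‖y.1 - z.1‖) :
    |(∫ U, loopTerm 2 1 (rectWalk x i j 1 1) U ∂(ymSpecification (d := 4) (fundamentalRep (Fin 2)) (βW / 2) Λ η)) -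
        ∫ U, loopTerm 2 1 (rectWalk x i j 1 1) U ∂μ| ≤ 64 * (1 / 2 : ℝ) ^ ⌊D⌋₊ := by
  have key := su2_wilson_rectangle_boundary_upTo_oneTwelfth h0 h hμ Λ η x i j 1 1 hD
  refine key.trans (le_of_eq ?_)
  push_cast
  norm_num

end Summit.Ventures.YMGap.RobustBall

end
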